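import Literature.NumberTheory.Sieve.PolymathGEHPolyEval
import Mathlib.Tactic.Ring
import Mathlib.Tactic.Linarith
import HarnessLib

/-!
# The piecewise polynomial cutoff of Polymath 8b, Theorem 3.15 — definition

Trunk AntSieve.  D. H. J. Polymath, *Variants of the Selberg sieve, and bounded intervals containing
many primes*, Res. Math. Sci. 1:12 (2014) = arXiv:1407.4897, **Theorem 3.15** (p. 11; proof in §7.4
"Three-dimensional cutoffs", pp. 31–34) is the numerical input which, together with Theorem 3.14,
gives Theorem 3.2(xii) `GEH ⟹ DHL[3,2]` (the named fact
`Literature.NumberTheory.Sieve.weakDHL_three_two_of_GEH` of `PolymathGEH.lean`).  It asserts the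
existence of a symmetric piecewise polynomial `F : [0,∞)³ → ℝ` supported on `(3/2)·R₃`, with vanishing
`t₃`-marginals when `t₁ + t₂ > 1 + ε` (`ε = 1/4`), and `3 J_{3,1-ε}(F) > 2 I(F)`.

This file DEFINES the printed `F` (no statement about it is assumed):

* `polyA, …, polyH` — the nine non-zero polynomial pieces `F↾A_{xyz}, …, F↾H_{xyz}` of p. 34,
  transcribed verbatim (`F↾D_{xyz} = 0`);
* `pieceA, …, pieceH : Set (Fin 3 → ℝ)` — the open polytopes `A_{xyz}, …, H_{xyz}` of the partition
  of `R_{xyz} = {0 < y < x < z} ∩ (3/2)·R₃` on pp. 32–33 (`ε = 1/4`: `1 - ε = 3/4`, `1 + ε = 5/4`,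
  `1/2 + ε = 3/4`, `1/2 - ε = 1/4`), coordinates `t 0 = x, t 1 = y, t 2 = z`;
* `Gfun` — `F` on the fundamental region (`Σ_P 1_P · F↾P`), and `F3` — its symmetric extension,
  the sum of `Gfun` over the six rearrangements of the coordinates (for a point with distinct
  coordinates exactly one rearrangement lies in `R_{xyz}`).  `F3` itself does not depend on how the
  permuted polytopes `P_{yzx}, …` are named; where the later files (`PolymathGEHCutoffFibres.lean`)
  need names they use `(x,y,z) ∈ P_{yzx} ⟺ (y,z,x) ∈ P_{xyz}` (value `F↾P(y,z,x)` there) — note this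
  is the reverse of the paper's displayed example `F↾A_{yzx}(x,y,z) = F↾A_{xyz}(z,x,y)` (p. 32), but it
  is the reading under which the displays `J₁, …, J₈` of p. 33 hold and the printed values of `I(F)`
  and `J(F)` are reproduced exactly;
* (the kernel data — the pieces as `GEHCutoff.Q3` coefficient lists with `simp; ring` bridge lemmas —
  live in the files that use them: `PolymathGEHCutoffI.lean`, `PolymathGEHCutoffFibres.lean`);
* evaluation lemmas: pairwise disjointness of the pieces, `Gfun_eq_of_mem_piece…`, `Gfun_sq`
  (`Gfun² = Gsq`, a sum of indicator terms), `Gfun_eq_zero_of_not_ordered`, and `F3_eq_…` (on each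
  order region only one rearrangement survives).

All proofs here are linear arithmetic on the defining inequalities.  Analytic properties of `F3`
(symmetry, measurability, boundedness, support, integrability) are in `PolymathGEHCutoffBasic.lean`;
the values `I(F) = 62082439864241/507343011840`, `J(F) = 9933190664926733/40587440947200` and the
marginal conditions follow in later files.

## References

* [Polymath8b2014] D. H. J. Polymath, Res. Math. Sci. 1 (2014), Art. 12 = arXiv:1407.4897,
  Theorem 3.15 (p. 11), §7.4 (pp. 31–34).
-/

noncomputable section

namespace Literature.NumberTheory.Sieve

namespace GEHCutoff

/-- `F↾A_{xyz}` (Polymath 8b, §7.4, p. 34, verbatim). [cite: Polymath8b2014, Section 7.4] -/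
def polyA (x y z : ℝ) : ℝ :=
  -66+96*x-147*x^2+125*x^3+128*y-122*x*y+104*x^2*y-275*y^2+394*y^3+99*z
    -58*x*z+63*x^2*z-98*y*z+51*x*y*z+41*y^2*z-112*z^2+24*x*z^2+72*y*z^2+50*z^3

/-- `F↾B_{xyz}` (Polymath 8b, §7.4, p. 34, verbatim). [cite: Polymath8b2014, Section 7.4] -/
def polyB (x y z : ℝ) : ℝ :=
  -41+52*x-73*x^2+25*x^3+108*y-66*x*y+71*x^2*y-294*y^2+56*x*y^2+363*y^3
    +33*z+15*x*z+22*x^2*z-40*y*z-42*x*y*z+75*y^2*z-36*z^2-24*x*z^2+26*y*z^2+20*z^3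

/-- `F↾C_{xyz}` (Polymath 8b, §7.4, p. 34, verbatim). [cite: Polymath8b2014, Section 7.4] -/
def polyC (x y _z : ℝ) : ℝ :=
  -22+45*x-35*x^2+63*y-99*x*y+82*x^2*y-140*y^2+54*x*y^2+179*y^3

/-- `F↾E_{xyz}` (Polymath 8b, §7.4, p. 34, verbatim). [cite: Polymath8b2014, Section 7.4] -/
def polyE (x y _z : ℝ) : ℝ :=
  -12+8*x+32*y

/-- `F↾S_{xyz}` (Polymath 8b, §7.4, p. 34, verbatim). [cite: Polymath8b2014, Section 7.4] -/
def polyS (x y _z : ℝ) : ℝ :=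
  -6+8*x+16*y

/-- `F↾T_{xyz}` (Polymath 8b, §7.4, p. 34, verbatim). [cite: Polymath8b2014, Section 7.4] -/
def polyT (x y z : ℝ) : ℝ :=
  18-30*x+12*x^2+42*y-20*x*y-66*y^2-45*z+34*x*z+22*z^2

/-- `F↾U_{xyz}` (Polymath 8b, §7.4, p. 34, verbatim). [cite: Polymath8b2014, Section 7.4] -/
def polyU (x y z : ℝ) : ℝ :=
  94-1823*x+5760*x^2-5128*x^3+54*y-168*x^2*y+105*y^2+1422*x*z-2340*x^2*z
    -192*y^2*z-128*z^2-268*x*z^2+64*z^3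

/-- `F↾G_{xyz}` (Polymath 8b, §7.4, p. 34, verbatim). [cite: Polymath8b2014, Section 7.4] -/
def polyG (x y z : ℝ) : ℝ :=
  5274-19833*x+18570*x^2-5128*x^3-18024*y+44696*x*y-20664*x^2*y+16158*y^2
    -19056*x*y^2-4592*y^3-10704*z+26860*x*z-12588*x^2*z+24448*y*z-30352*x*y*z
    -10980*y^2*z+7240*z^2-9092*x*z^2-8288*y*z^2-1632*z^3

/-- `F↾H_{xyz}` (Polymath 8b, §7.4, p. 34, verbatim). [cite: Polymath8b2014, Section 7.4] -/
def polyH (_x _y z : ℝ) : ℝ :=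
  8*z

/-! ### The ten polytopes of `R_{xyz}` (the zero piece `D_{xyz}` is omitted) -/

/-- The open polytope `A_{xyz} = {x+y < y+z < z+x < 1-ε}` inside `R_{xyz} = {0 < y < x < z, x+y+z < 3/2}` (ε = 1/4;
coordinates `t 0 = x, t 1 = y, t 2 = z`). [cite: Polymath8b2014, Section 7.4] -/
def pieceA : Set (Fin 3 → ℝ) :=
  {t | (0 < t 1 ∧ t 1 < t 0 ∧ t 0 < t 2 ∧ t 0 + t 1 + t 2 < 3/2) ∧
    (t 2 + t 0 < 3/4)}

/-- The open polytope `B_{xyz} = {x+y < y+z < 1-ε < z+x < 1+ε}` inside `R_{xyz} = {0 < y < x < z, x+y+z < 3/2}` (ε = 1/4;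
coordinates `t 0 = x, t 1 = y, t 2 = z`). [cite: Polymath8b2014, Section 7.4] -/
def pieceB : Set (Fin 3 → ℝ) :=
  {t | (0 < t 1 ∧ t 1 < t 0 ∧ t 0 < t 2 ∧ t 0 + t 1 + t 2 < 3/2) ∧
    (t 1 + t 2 < 3/4 ∧ 3/4 < t 2 + t 0 ∧ t 2 + t 0 < 5/4)}

/-- The open polytope `C_{xyz} = {x+y < 1-ε < y+z < z+x < 1+ε}` inside `R_{xyz} = {0 < y < x < z, x+y+z < 3/2}` (ε = 1/4;
coordinates `t 0 = x, t 1 = y, t 2 = z`). [cite: Polymath8b2014, Section 7.4] -/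
def pieceC : Set (Fin 3 → ℝ) :=
  {t | (0 < t 1 ∧ t 1 < t 0 ∧ t 0 < t 2 ∧ t 0 + t 1 + t 2 < 3/2) ∧
    (t 0 + t 1 < 3/4 ∧ 3/4 < t 1 + t 2 ∧ t 2 + t 0 < 5/4)}

/-- The open polytope `E_{xyz} = {x+y < y+z < 1-ε < 1+ε < z+x}` inside `R_{xyz} = {0 < y < x < z, x+y+z < 3/2}` (ε = 1/4;
coordinates `t 0 = x, t 1 = y, t 2 = z`). [cite: Polymath8b2014, Section 7.4] -/
def pieceE : Set (Fin 3 → ℝ) :=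
  {t | (0 < t 1 ∧ t 1 < t 0 ∧ t 0 < t 2 ∧ t 0 + t 1 + t 2 < 3/2) ∧
    (t 1 + t 2 < 3/4 ∧ 5/4 < t 2 + t 0)}

/-- The open polytope `S_{xyz} = F_{xyz} ∩ {z < 1/2+ε}, F_{xyz} = {x+y < 1-ε < y+z < 1+ε < z+x}` inside `R_{xyz} = {0 < y < x < z, x+y+z < 3/2}` (ε = 1/4;
coordinates `t 0 = x, t 1 = y, t 2 = z`). [cite: Polymath8b2014, Section 7.4] -/
def pieceS : Set (Fin 3 → ℝ) :=
  {t | (0 < t 1 ∧ t 1 < t 0 ∧ t 0 < t 2 ∧ t 0 + t 1 + t 2 < 3/2) ∧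
    (t 0 + t 1 < 3/4 ∧ 3/4 < t 1 + t 2 ∧ t 1 + t 2 < 5/4 ∧ 5/4 < t 2 + t 0 ∧ t 2 < 3/4)}

/-- The open polytope `T_{xyz} = F_{xyz} ∩ {z > 1/2+ε, x > 1/2-ε}` inside `R_{xyz} = {0 < y < x < z, x+y+z < 3/2}` (ε = 1/4;
coordinates `t 0 = x, t 1 = y, t 2 = z`). [cite: Polymath8b2014, Section 7.4] -/
def pieceT : Set (Fin 3 → ℝ) :=
  {t | (0 < t 1 ∧ t 1 < t 0 ∧ t 0 < t 2 ∧ t 0 + t 1 + t 2 < 3/2) ∧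
    (t 0 + t 1 < 3/4 ∧ 3/4 < t 1 + t 2 ∧ t 1 + t 2 < 5/4 ∧ 5/4 < t 2 + t 0 ∧ 3/4 < t 2 ∧ 1/4 < t 0)}

/-- The open polytope `U_{xyz} = F_{xyz} ∩ {x < 1/2-ε}` inside `R_{xyz} = {0 < y < x < z, x+y+z < 3/2}` (ε = 1/4;
coordinates `t 0 = x, t 1 = y, t 2 = z`). [cite: Polymath8b2014, Section 7.4] -/
def pieceU : Set (Fin 3 → ℝ) :=
  {t | (0 < t 1 ∧ t 1 < t 0 ∧ t 0 < t 2 ∧ t 0 + t 1 + t 2 < 3/2) ∧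
    (t 0 + t 1 < 3/4 ∧ 3/4 < t 1 + t 2 ∧ t 1 + t 2 < 5/4 ∧ 5/4 < t 2 + t 0 ∧ t 0 < 1/4)}

/-- The open polytope `G_{xyz} = {x+y < 1-ε < 1+ε < y+z < z+x}` inside `R_{xyz} = {0 < y < x < z, x+y+z < 3/2}` (ε = 1/4;
coordinates `t 0 = x, t 1 = y, t 2 = z`). [cite: Polymath8b2014, Section 7.4] -/
def pieceG : Set (Fin 3 → ℝ) :=
  {t | (0 < t 1 ∧ t 1 < t 0 ∧ t 0 < t 2 ∧ t 0 + t 1 + t 2 < 3/2) ∧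
    (t 0 + t 1 < 3/4 ∧ 5/4 < t 1 + t 2)}

/-- The open polytope `H_{xyz} = {1-ε < x+y < y+z < 1+ε < z+x}` inside `R_{xyz} = {0 < y < x < z, x+y+z < 3/2}` (ε = 1/4;
coordinates `t 0 = x, t 1 = y, t 2 = z`). [cite: Polymath8b2014, Section 7.4] -/
def pieceH : Set (Fin 3 → ℝ) :=
  {t | (0 < t 1 ∧ t 1 < t 0 ∧ t 0 < t 2 ∧ t 0 + t 1 + t 2 < 3/2) ∧
    (3/4 < t 0 + t 1 ∧ t 1 + t 2 < 5/4 ∧ 5/4 < t 2 + t 0)}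

/-! ### The cutoff on the fundamental region and its symmetric extension -/

/-- `F` restricted to the fundamental region `R_{xyz}`: the polynomial `F↾P` on each polytope `P`
(Polymath 8b, §7.4, p. 34; `F↾D_{xyz} = 0`). [cite: Polymath8b2014, Section 7.4] -/
def Gfun (t : Fin 3 → ℝ) : ℝ :=
  pieceA.indicator (fun t => polyA (t 0) (t 1) (t 2)) t +
  pieceB.indicator (fun t => polyB (t 0) (t 1) (t 2)) t +
  pieceC.indicator (fun t => polyC (t 0) (t 1) (t 2)) t +
  pieceE.indicator (fun t => polyE (t 0) (t 1) (t 2)) t +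
  pieceS.indicator (fun t => polyS (t 0) (t 1) (t 2)) t +
  pieceT.indicator (fun t => polyT (t 0) (t 1) (t 2)) t +
  pieceU.indicator (fun t => polyU (t 0) (t 1) (t 2)) t +
  pieceG.indicator (fun t => polyG (t 0) (t 1) (t 2)) t +
  pieceH.indicator (fun t => polyH (t 0) (t 1) (t 2)) t

/-- **The cutoff `F` of Theorem 3.15**: the symmetric extension of `Gfun` to `(3/2)·R₃`, i.e.
`F(t) = F↾P_{xyz}` at the rearrangement of `t` lying in `R_{xyz}` ("extending by symmetry", p. 32).
Written as the sum over the six rearrangements (at most one of which lies in `R_{xyz}`).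
[cite: Polymath8b2014, Theorem 3.15] -/
def F3 (t : Fin 3 → ℝ) : ℝ :=
  Gfun ![t 0, t 1, t 2] +
  Gfun ![t 1, t 0, t 2] +
  Gfun ![t 0, t 2, t 1] +
  Gfun ![t 2, t 1, t 0] +
  Gfun ![t 1, t 2, t 0] +
  Gfun ![t 2, t 0, t 1]

/-! ### Evaluating `Gfun` and `F3` -/

/-- Off the order region `{0 < y < x < z}` every piece is empty, so `Gfun = 0`. [cite: Polymath8b2014, Section 7.4] -/
theorem Gfun_eq_zero_of_not_ordered {t : Fin 3 → ℝ} (h : ¬ (0 < t 1 ∧ t 1 < t 0 ∧ t 0 < t 2)) : Gfun t = 0 := by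
  simp only [Gfun]
  rw [Set.indicator_of_notMem (s := pieceA), Set.indicator_of_notMem (s := pieceB), Set.indicator_of_notMem (s := pieceC), Set.indicator_of_notMem (s := pieceE), Set.indicator_of_notMem (s := pieceS), Set.indicator_of_notMem (s := pieceT), Set.indicator_of_notMem (s := pieceU), Set.indicator_of_notMem (s := pieceG), Set.indicator_of_notMem (s := pieceH)]
  · simp
  · exact fun hm => h ⟨hm.1.1, hm.1.2.1, hm.1.2.2.1⟩
  · exact fun hm => h ⟨hm.1.1, hm.1.2.1, hm.1.2.2.1⟩
  · exact fun hm => h ⟨hm.1.1, hm.1.2.1, hm.1.2.2.1⟩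
  · exact fun hm => h ⟨hm.1.1, hm.1.2.1, hm.1.2.2.1⟩
  · exact fun hm => h ⟨hm.1.1, hm.1.2.1, hm.1.2.2.1⟩
  · exact fun hm => h ⟨hm.1.1, hm.1.2.1, hm.1.2.2.1⟩
  · exact fun hm => h ⟨hm.1.1, hm.1.2.1, hm.1.2.2.1⟩
  · exact fun hm => h ⟨hm.1.1, hm.1.2.1, hm.1.2.2.1⟩
  · exact fun hm => h ⟨hm.1.1, hm.1.2.1, hm.1.2.2.1⟩


/-- Beyond the slanted face `x+y+z = 3/2` every piece is empty, so `Gfun = 0`. [cite: Polymath8b2014, Section 7.4] -/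
theorem Gfun_eq_zero_of_le_sum {t : Fin 3 → ℝ} (h : 3 / 2 ≤ t 0 + t 1 + t 2) : Gfun t = 0 := by
  simp only [Gfun]
  rw [Set.indicator_of_notMem (s := pieceA), Set.indicator_of_notMem (s := pieceB), Set.indicator_of_notMem (s := pieceC), Set.indicator_of_notMem (s := pieceE), Set.indicator_of_notMem (s := pieceS), Set.indicator_of_notMem (s := pieceT), Set.indicator_of_notMem (s := pieceU), Set.indicator_of_notMem (s := pieceG), Set.indicator_of_notMem (s := pieceH)]
  · simp
  · exact fun hm => absurd hm.1.2.2.2 (not_lt.2 h)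
  · exact fun hm => absurd hm.1.2.2.2 (not_lt.2 h)
  · exact fun hm => absurd hm.1.2.2.2 (not_lt.2 h)
  · exact fun hm => absurd hm.1.2.2.2 (not_lt.2 h)
  · exact fun hm => absurd hm.1.2.2.2 (not_lt.2 h)
  · exact fun hm => absurd hm.1.2.2.2 (not_lt.2 h)
  · exact fun hm => absurd hm.1.2.2.2 (not_lt.2 h)
  · exact fun hm => absurd hm.1.2.2.2 (not_lt.2 h)
  · exact fun hm => absurd hm.1.2.2.2 (not_lt.2 h)

/-! ### The pieces are pairwise disjoint -/


/-- `A` and `B` are disjoint. [cite: Polymath8b2014, Section 7.4] -/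
theorem not_mem_pieceB_of_mem_pieceA {t : Fin 3 → ℝ} (h : t ∈ pieceA) : t ∉ pieceB := fun h' => by
  obtain ⟨⟨hb0, hb1, hb2, hb3⟩, he0⟩ := h
  obtain ⟨⟨gb0, gb1, gb2, gb3⟩, ⟨ge0, ge1, ge2⟩⟩ := h'
  linarith


/-- `A` and `C` are disjoint. [cite: Polymath8b2014, Section 7.4] -/
theorem not_mem_pieceC_of_mem_pieceA {t : Fin 3 → ℝ} (h : t ∈ pieceA) : t ∉ pieceC := fun h' => by
  obtain ⟨⟨hb0, hb1, hb2, hb3⟩, he0⟩ := h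
  obtain ⟨⟨gb0, gb1, gb2, gb3⟩, ⟨ge0, ge1, ge2⟩⟩ := h'
  linarith


/-- `A` and `E` are disjoint. [cite: Polymath8b2014, Section 7.4] -/
theorem not_mem_pieceE_of_mem_pieceA {t : Fin 3 → ℝ} (h : t ∈ pieceA) : t ∉ pieceE := fun h' => by
  obtain ⟨⟨hb0, hb1, hb2, hb3⟩, he0⟩ := h
  obtain ⟨⟨gb0, gb1, gb2, gb3⟩, ⟨ge0, ge1⟩⟩ := h'
  linarith


/-- `A` and `S` are disjoint. [cite: Polymath8b2014, Section 7.4] -/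
theorem not_mem_pieceS_of_mem_pieceA {t : Fin 3 → ℝ} (h : t ∈ pieceA) : t ∉ pieceS := fun h' => by
  obtain ⟨⟨hb0, hb1, hb2, hb3⟩, he0⟩ := h
  obtain ⟨⟨gb0, gb1, gb2, gb3⟩, ⟨ge0, ge1, ge2, ge3, ge4⟩⟩ := h'
  linarith


/-- `A` and `T` are disjoint. [cite: Polymath8b2014, Section 7.4] -/
theorem not_mem_pieceT_of_mem_pieceA {t : Fin 3 → ℝ} (h : t ∈ pieceA) : t ∉ pieceT := fun h' => by
  obtain ⟨⟨hb0, hb1, hb2, hb3⟩, he0⟩ := h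
  obtain ⟨⟨gb0, gb1, gb2, gb3⟩, ⟨ge0, ge1, ge2, ge3, ge4, ge5⟩⟩ := h'
  linarith


/-- `A` and `U` are disjoint. [cite: Polymath8b2014, Section 7.4] -/
theorem not_mem_pieceU_of_mem_pieceA {t : Fin 3 → ℝ} (h : t ∈ pieceA) : t ∉ pieceU := fun h' => by
  obtain ⟨⟨hb0, hb1, hb2, hb3⟩, he0⟩ := h
  obtain ⟨⟨gb0, gb1, gb2, gb3⟩, ⟨ge0, ge1, ge2, ge3, ge4⟩⟩ := h'
  linarith


/-- `A` and `G` are disjoint. [cite: Polymath8b2014, Section 7.4] -/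
theorem not_mem_pieceG_of_mem_pieceA {t : Fin 3 → ℝ} (h : t ∈ pieceA) : t ∉ pieceG := fun h' => by
  obtain ⟨⟨hb0, hb1, hb2, hb3⟩, he0⟩ := h
  obtain ⟨⟨gb0, gb1, gb2, gb3⟩, ⟨ge0, ge1⟩⟩ := h'
  linarith


/-- `A` and `H` are disjoint. [cite: Polymath8b2014, Section 7.4] -/
theorem not_mem_pieceH_of_mem_pieceA {t : Fin 3 → ℝ} (h : t ∈ pieceA) : t ∉ pieceH := fun h' => by
  obtain ⟨⟨hb0, hb1, hb2, hb3⟩, he0⟩ := h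
  obtain ⟨⟨gb0, gb1, gb2, gb3⟩, ⟨ge0, ge1, ge2⟩⟩ := h'
  linarith


/-- `B` and `A` are disjoint. [cite: Polymath8b2014, Section 7.4] -/
theorem not_mem_pieceA_of_mem_pieceB {t : Fin 3 → ℝ} (h : t ∈ pieceB) : t ∉ pieceA := fun h' => by
  obtain ⟨⟨hb0, hb1, hb2, hb3⟩, ⟨he0, he1, he2⟩⟩ := h
  obtain ⟨⟨gb0, gb1, gb2, gb3⟩, ge0⟩ := h'
  linarith


/-- `B` and `C` are disjoint. [cite: Polymath8b2014, Section 7.4] -/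
theorem not_mem_pieceC_of_mem_pieceB {t : Fin 3 → ℝ} (h : t ∈ pieceB) : t ∉ pieceC := fun h' => by
  obtain ⟨⟨hb0, hb1, hb2, hb3⟩, ⟨he0, he1, he2⟩⟩ := h
  obtain ⟨⟨gb0, gb1, gb2, gb3⟩, ⟨ge0, ge1, ge2⟩⟩ := h'
  linarith


/-- `B` and `E` are disjoint. [cite: Polymath8b2014, Section 7.4] -/
theorem not_mem_pieceE_of_mem_pieceB {t : Fin 3 → ℝ} (h : t ∈ pieceB) : t ∉ pieceE := fun h' => by
  obtain ⟨⟨hb0, hb1, hb2, hb3⟩, ⟨he0, he1, he2⟩⟩ := h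
  obtain ⟨⟨gb0, gb1, gb2, gb3⟩, ⟨ge0, ge1⟩⟩ := h'
  linarith


/-- `B` and `S` are disjoint. [cite: Polymath8b2014, Section 7.4] -/
theorem not_mem_pieceS_of_mem_pieceB {t : Fin 3 → ℝ} (h : t ∈ pieceB) : t ∉ pieceS := fun h' => by
  obtain ⟨⟨hb0, hb1, hb2, hb3⟩, ⟨he0, he1, he2⟩⟩ := h
  obtain ⟨⟨gb0, gb1, gb2, gb3⟩, ⟨ge0, ge1, ge2, ge3, ge4⟩⟩ := h'
  linarith


/-- `B` and `T` are disjoint. [cite: Polymath8b2014, Section 7.4] -/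
theorem not_mem_pieceT_of_mem_pieceB {t : Fin 3 → ℝ} (h : t ∈ pieceB) : t ∉ pieceT := fun h' => by
  obtain ⟨⟨hb0, hb1, hb2, hb3⟩, ⟨he0, he1, he2⟩⟩ := h
  obtain ⟨⟨gb0, gb1, gb2, gb3⟩, ⟨ge0, ge1, ge2, ge3, ge4, ge5⟩⟩ := h'
  linarith


/-- `B` and `U` are disjoint. [cite: Polymath8b2014, Section 7.4] -/
theorem not_mem_pieceU_of_mem_pieceB {t : Fin 3 → ℝ} (h : t ∈ pieceB) : t ∉ pieceU := fun h' => by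
  obtain ⟨⟨hb0, hb1, hb2, hb3⟩, ⟨he0, he1, he2⟩⟩ := h
  obtain ⟨⟨gb0, gb1, gb2, gb3⟩, ⟨ge0, ge1, ge2, ge3, ge4⟩⟩ := h'
  linarith


/-- `B` and `G` are disjoint. [cite: Polymath8b2014, Section 7.4] -/
theorem not_mem_pieceG_of_mem_pieceB {t : Fin 3 → ℝ} (h : t ∈ pieceB) : t ∉ pieceG := fun h' => by
  obtain ⟨⟨hb0, hb1, hb2, hb3⟩, ⟨he0, he1, he2⟩⟩ := h
  obtain ⟨⟨gb0, gb1, gb2, gb3⟩, ⟨ge0, ge1⟩⟩ := h'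
  linarith


/-- `B` and `H` are disjoint. [cite: Polymath8b2014, Section 7.4] -/
theorem not_mem_pieceH_of_mem_pieceB {t : Fin 3 → ℝ} (h : t ∈ pieceB) : t ∉ pieceH := fun h' => by
  obtain ⟨⟨hb0, hb1, hb2, hb3⟩, ⟨he0, he1, he2⟩⟩ := h
  obtain ⟨⟨gb0, gb1, gb2, gb3⟩, ⟨ge0, ge1, ge2⟩⟩ := h'
  linarith


/-- `C` and `A` are disjoint. [cite: Polymath8b2014, Section 7.4] -/
theorem not_mem_pieceA_of_mem_pieceC {t : Fin 3 → ℝ} (h : t ∈ pieceC) : t ∉ pieceA := fun h' => by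
  obtain ⟨⟨hb0, hb1, hb2, hb3⟩, ⟨he0, he1, he2⟩⟩ := h
  obtain ⟨⟨gb0, gb1, gb2, gb3⟩, ge0⟩ := h'
  linarith


/-- `C` and `B` are disjoint. [cite: Polymath8b2014, Section 7.4] -/
theorem not_mem_pieceB_of_mem_pieceC {t : Fin 3 → ℝ} (h : t ∈ pieceC) : t ∉ pieceB := fun h' => by
  obtain ⟨⟨hb0, hb1, hb2, hb3⟩, ⟨he0, he1, he2⟩⟩ := h
  obtain ⟨⟨gb0, gb1, gb2, gb3⟩, ⟨ge0, ge1, ge2⟩⟩ := h'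
  linarith


/-- `C` and `E` are disjoint. [cite: Polymath8b2014, Section 7.4] -/
theorem not_mem_pieceE_of_mem_pieceC {t : Fin 3 → ℝ} (h : t ∈ pieceC) : t ∉ pieceE := fun h' => by
  obtain ⟨⟨hb0, hb1, hb2, hb3⟩, ⟨he0, he1, he2⟩⟩ := h
  obtain ⟨⟨gb0, gb1, gb2, gb3⟩, ⟨ge0, ge1⟩⟩ := h'
  linarith


/-- `C` and `S` are disjoint. [cite: Polymath8b2014, Section 7.4] -/
theorem not_mem_pieceS_of_mem_pieceC {t : Fin 3 → ℝ} (h : t ∈ pieceC) : t ∉ pieceS := fun h' => by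
  obtain ⟨⟨hb0, hb1, hb2, hb3⟩, ⟨he0, he1, he2⟩⟩ := h
  obtain ⟨⟨gb0, gb1, gb2, gb3⟩, ⟨ge0, ge1, ge2, ge3, ge4⟩⟩ := h'
  linarith


/-- `C` and `T` are disjoint. [cite: Polymath8b2014, Section 7.4] -/
theorem not_mem_pieceT_of_mem_pieceC {t : Fin 3 → ℝ} (h : t ∈ pieceC) : t ∉ pieceT := fun h' => by
  obtain ⟨⟨hb0, hb1, hb2, hb3⟩, ⟨he0, he1, he2⟩⟩ := h
  obtain ⟨⟨gb0, gb1, gb2, gb3⟩, ⟨ge0, ge1, ge2, ge3, ge4, ge5⟩⟩ := h'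
  linarith


/-- `C` and `U` are disjoint. [cite: Polymath8b2014, Section 7.4] -/
theorem not_mem_pieceU_of_mem_pieceC {t : Fin 3 → ℝ} (h : t ∈ pieceC) : t ∉ pieceU := fun h' => by
  obtain ⟨⟨hb0, hb1, hb2, hb3⟩, ⟨he0, he1, he2⟩⟩ := h
  obtain ⟨⟨gb0, gb1, gb2, gb3⟩, ⟨ge0, ge1, ge2, ge3, ge4⟩⟩ := h'
  linarith


/-- `C` and `G` are disjoint. [cite: Polymath8b2014, Section 7.4] -/
theorem not_mem_pieceG_of_mem_pieceC {t : Fin 3 → ℝ} (h : t ∈ pieceC) : t ∉ pieceG := fun h' => by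
  obtain ⟨⟨hb0, hb1, hb2, hb3⟩, ⟨he0, he1, he2⟩⟩ := h
  obtain ⟨⟨gb0, gb1, gb2, gb3⟩, ⟨ge0, ge1⟩⟩ := h'
  linarith


/-- `C` and `H` are disjoint. [cite: Polymath8b2014, Section 7.4] -/
theorem not_mem_pieceH_of_mem_pieceC {t : Fin 3 → ℝ} (h : t ∈ pieceC) : t ∉ pieceH := fun h' => by
  obtain ⟨⟨hb0, hb1, hb2, hb3⟩, ⟨he0, he1, he2⟩⟩ := h
  obtain ⟨⟨gb0, gb1, gb2, gb3⟩, ⟨ge0, ge1, ge2⟩⟩ := h'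
  linarith


/-- `E` and `A` are disjoint. [cite: Polymath8b2014, Section 7.4] -/
theorem not_mem_pieceA_of_mem_pieceE {t : Fin 3 → ℝ} (h : t ∈ pieceE) : t ∉ pieceA := fun h' => by
  obtain ⟨⟨hb0, hb1, hb2, hb3⟩, ⟨he0, he1⟩⟩ := h
  obtain ⟨⟨gb0, gb1, gb2, gb3⟩, ge0⟩ := h'
  linarith


/-- `E` and `B` are disjoint. [cite: Polymath8b2014, Section 7.4] -/
theorem not_mem_pieceB_of_mem_pieceE {t : Fin 3 → ℝ} (h : t ∈ pieceE) : t ∉ pieceB := fun h' => by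
  obtain ⟨⟨hb0, hb1, hb2, hb3⟩, ⟨he0, he1⟩⟩ := h
  obtain ⟨⟨gb0, gb1, gb2, gb3⟩, ⟨ge0, ge1, ge2⟩⟩ := h'
  linarith


/-- `E` and `C` are disjoint. [cite: Polymath8b2014, Section 7.4] -/
theorem not_mem_pieceC_of_mem_pieceE {t : Fin 3 → ℝ} (h : t ∈ pieceE) : t ∉ pieceC := fun h' => by
  obtain ⟨⟨hb0, hb1, hb2, hb3⟩, ⟨he0, he1⟩⟩ := h
  obtain ⟨⟨gb0, gb1, gb2, gb3⟩, ⟨ge0, ge1, ge2⟩⟩ := h'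
  linarith


/-- `E` and `S` are disjoint. [cite: Polymath8b2014, Section 7.4] -/
theorem not_mem_pieceS_of_mem_pieceE {t : Fin 3 → ℝ} (h : t ∈ pieceE) : t ∉ pieceS := fun h' => by
  obtain ⟨⟨hb0, hb1, hb2, hb3⟩, ⟨he0, he1⟩⟩ := h
  obtain ⟨⟨gb0, gb1, gb2, gb3⟩, ⟨ge0, ge1, ge2, ge3, ge4⟩⟩ := h'
  linarith


/-- `E` and `T` are disjoint. [cite: Polymath8b2014, Section 7.4] -/
theorem not_mem_pieceT_of_mem_pieceE {t : Fin 3 → ℝ} (h : t ∈ pieceE) : t ∉ pieceT := fun h' => by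
  obtain ⟨⟨hb0, hb1, hb2, hb3⟩, ⟨he0, he1⟩⟩ := h
  obtain ⟨⟨gb0, gb1, gb2, gb3⟩, ⟨ge0, ge1, ge2, ge3, ge4, ge5⟩⟩ := h'
  linarith


/-- `E` and `U` are disjoint. [cite: Polymath8b2014, Section 7.4] -/
theorem not_mem_pieceU_of_mem_pieceE {t : Fin 3 → ℝ} (h : t ∈ pieceE) : t ∉ pieceU := fun h' => by
  obtain ⟨⟨hb0, hb1, hb2, hb3⟩, ⟨he0, he1⟩⟩ := h
  obtain ⟨⟨gb0, gb1, gb2, gb3⟩, ⟨ge0, ge1, ge2, ge3, ge4⟩⟩ := h'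
  linarith


/-- `E` and `G` are disjoint. [cite: Polymath8b2014, Section 7.4] -/
theorem not_mem_pieceG_of_mem_pieceE {t : Fin 3 → ℝ} (h : t ∈ pieceE) : t ∉ pieceG := fun h' => by
  obtain ⟨⟨hb0, hb1, hb2, hb3⟩, ⟨he0, he1⟩⟩ := h
  obtain ⟨⟨gb0, gb1, gb2, gb3⟩, ⟨ge0, ge1⟩⟩ := h'
  linarith


/-- `E` and `H` are disjoint. [cite: Polymath8b2014, Section 7.4] -/
theorem not_mem_pieceH_of_mem_pieceE {t : Fin 3 → ℝ} (h : t ∈ pieceE) : t ∉ pieceH := fun h' => by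
  obtain ⟨⟨hb0, hb1, hb2, hb3⟩, ⟨he0, he1⟩⟩ := h
  obtain ⟨⟨gb0, gb1, gb2, gb3⟩, ⟨ge0, ge1, ge2⟩⟩ := h'
  linarith


/-- `S` and `A` are disjoint. [cite: Polymath8b2014, Section 7.4] -/
theorem not_mem_pieceA_of_mem_pieceS {t : Fin 3 → ℝ} (h : t ∈ pieceS) : t ∉ pieceA := fun h' => by
  obtain ⟨⟨hb0, hb1, hb2, hb3⟩, ⟨he0, he1, he2, he3, he4⟩⟩ := h
  obtain ⟨⟨gb0, gb1, gb2, gb3⟩, ge0⟩ := h'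
  linarith


/-- `S` and `B` are disjoint. [cite: Polymath8b2014, Section 7.4] -/
theorem not_mem_pieceB_of_mem_pieceS {t : Fin 3 → ℝ} (h : t ∈ pieceS) : t ∉ pieceB := fun h' => by
  obtain ⟨⟨hb0, hb1, hb2, hb3⟩, ⟨he0, he1, he2, he3, he4⟩⟩ := h
  obtain ⟨⟨gb0, gb1, gb2, gb3⟩, ⟨ge0, ge1, ge2⟩⟩ := h'
  linarith


/-- `S` and `C` are disjoint. [cite: Polymath8b2014, Section 7.4] -/
theorem not_mem_pieceC_of_mem_pieceS {t : Fin 3 → ℝ} (h : t ∈ pieceS) : t ∉ pieceC := fun h' => by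
  obtain ⟨⟨hb0, hb1, hb2, hb3⟩, ⟨he0, he1, he2, he3, he4⟩⟩ := h
  obtain ⟨⟨gb0, gb1, gb2, gb3⟩, ⟨ge0, ge1, ge2⟩⟩ := h'
  linarith


/-- `S` and `E` are disjoint. [cite: Polymath8b2014, Section 7.4] -/
theorem not_mem_pieceE_of_mem_pieceS {t : Fin 3 → ℝ} (h : t ∈ pieceS) : t ∉ pieceE := fun h' => by
  obtain ⟨⟨hb0, hb1, hb2, hb3⟩, ⟨he0, he1, he2, he3, he4⟩⟩ := h
  obtain ⟨⟨gb0, gb1, gb2, gb3⟩, ⟨ge0, ge1⟩⟩ := h'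
  linarith


/-- `S` and `T` are disjoint. [cite: Polymath8b2014, Section 7.4] -/
theorem not_mem_pieceT_of_mem_pieceS {t : Fin 3 → ℝ} (h : t ∈ pieceS) : t ∉ pieceT := fun h' => by
  obtain ⟨⟨hb0, hb1, hb2, hb3⟩, ⟨he0, he1, he2, he3, he4⟩⟩ := h
  obtain ⟨⟨gb0, gb1, gb2, gb3⟩, ⟨ge0, ge1, ge2, ge3, ge4, ge5⟩⟩ := h'
  linarith


/-- `S` and `U` are disjoint. [cite: Polymath8b2014, Section 7.4] -/
theorem not_mem_pieceU_of_mem_pieceS {t : Fin 3 → ℝ} (h : t ∈ pieceS) : t ∉ pieceU := fun h' => by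
  obtain ⟨⟨hb0, hb1, hb2, hb3⟩, ⟨he0, he1, he2, he3, he4⟩⟩ := h
  obtain ⟨⟨gb0, gb1, gb2, gb3⟩, ⟨ge0, ge1, ge2, ge3, ge4⟩⟩ := h'
  linarith


/-- `S` and `G` are disjoint. [cite: Polymath8b2014, Section 7.4] -/
theorem not_mem_pieceG_of_mem_pieceS {t : Fin 3 → ℝ} (h : t ∈ pieceS) : t ∉ pieceG := fun h' => by
  obtain ⟨⟨hb0, hb1, hb2, hb3⟩, ⟨he0, he1, he2, he3, he4⟩⟩ := h
  obtain ⟨⟨gb0, gb1, gb2, gb3⟩, ⟨ge0, ge1⟩⟩ := h'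
  linarith


/-- `S` and `H` are disjoint. [cite: Polymath8b2014, Section 7.4] -/
theorem not_mem_pieceH_of_mem_pieceS {t : Fin 3 → ℝ} (h : t ∈ pieceS) : t ∉ pieceH := fun h' => by
  obtain ⟨⟨hb0, hb1, hb2, hb3⟩, ⟨he0, he1, he2, he3, he4⟩⟩ := h
  obtain ⟨⟨gb0, gb1, gb2, gb3⟩, ⟨ge0, ge1, ge2⟩⟩ := h'
  linarith


/-- `T` and `A` are disjoint. [cite: Polymath8b2014, Section 7.4] -/
theorem not_mem_pieceA_of_mem_pieceT {t : Fin 3 → ℝ} (h : t ∈ pieceT) : t ∉ pieceA := fun h' => by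
  obtain ⟨⟨hb0, hb1, hb2, hb3⟩, ⟨he0, he1, he2, he3, he4, he5⟩⟩ := h
  obtain ⟨⟨gb0, gb1, gb2, gb3⟩, ge0⟩ := h'
  linarith


/-- `T` and `B` are disjoint. [cite: Polymath8b2014, Section 7.4] -/
theorem not_mem_pieceB_of_mem_pieceT {t : Fin 3 → ℝ} (h : t ∈ pieceT) : t ∉ pieceB := fun h' => by
  obtain ⟨⟨hb0, hb1, hb2, hb3⟩, ⟨he0, he1, he2, he3, he4, he5⟩⟩ := h
  obtain ⟨⟨gb0, gb1, gb2, gb3⟩, ⟨ge0, ge1, ge2⟩⟩ := h'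
  linarith


/-- `T` and `C` are disjoint. [cite: Polymath8b2014, Section 7.4] -/
theorem not_mem_pieceC_of_mem_pieceT {t : Fin 3 → ℝ} (h : t ∈ pieceT) : t ∉ pieceC := fun h' => by
  obtain ⟨⟨hb0, hb1, hb2, hb3⟩, ⟨he0, he1, he2, he3, he4, he5⟩⟩ := h
  obtain ⟨⟨gb0, gb1, gb2, gb3⟩, ⟨ge0, ge1, ge2⟩⟩ := h'
  linarith


/-- `T` and `E` are disjoint. [cite: Polymath8b2014, Section 7.4] -/
theorem not_mem_pieceE_of_mem_pieceT {t : Fin 3 → ℝ} (h : t ∈ pieceT) : t ∉ pieceE := fun h' => by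
  obtain ⟨⟨hb0, hb1, hb2, hb3⟩, ⟨he0, he1, he2, he3, he4, he5⟩⟩ := h
  obtain ⟨⟨gb0, gb1, gb2, gb3⟩, ⟨ge0, ge1⟩⟩ := h'
  linarith


/-- `T` and `S` are disjoint. [cite: Polymath8b2014, Section 7.4] -/
theorem not_mem_pieceS_of_mem_pieceT {t : Fin 3 → ℝ} (h : t ∈ pieceT) : t ∉ pieceS := fun h' => by
  obtain ⟨⟨hb0, hb1, hb2, hb3⟩, ⟨he0, he1, he2, he3, he4, he5⟩⟩ := h
  obtain ⟨⟨gb0, gb1, gb2, gb3⟩, ⟨ge0, ge1, ge2, ge3, ge4⟩⟩ := h'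
  linarith


/-- `T` and `U` are disjoint. [cite: Polymath8b2014, Section 7.4] -/
theorem not_mem_pieceU_of_mem_pieceT {t : Fin 3 → ℝ} (h : t ∈ pieceT) : t ∉ pieceU := fun h' => by
  obtain ⟨⟨hb0, hb1, hb2, hb3⟩, ⟨he0, he1, he2, he3, he4, he5⟩⟩ := h
  obtain ⟨⟨gb0, gb1, gb2, gb3⟩, ⟨ge0, ge1, ge2, ge3, ge4⟩⟩ := h'
  linarith


/-- `T` and `G` are disjoint. [cite: Polymath8b2014, Section 7.4] -/
theorem not_mem_pieceG_of_mem_pieceT {t : Fin 3 → ℝ} (h : t ∈ pieceT) : t ∉ pieceG := fun h' => by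
  obtain ⟨⟨hb0, hb1, hb2, hb3⟩, ⟨he0, he1, he2, he3, he4, he5⟩⟩ := h
  obtain ⟨⟨gb0, gb1, gb2, gb3⟩, ⟨ge0, ge1⟩⟩ := h'
  linarith


/-- `T` and `H` are disjoint. [cite: Polymath8b2014, Section 7.4] -/
theorem not_mem_pieceH_of_mem_pieceT {t : Fin 3 → ℝ} (h : t ∈ pieceT) : t ∉ pieceH := fun h' => by
  obtain ⟨⟨hb0, hb1, hb2, hb3⟩, ⟨he0, he1, he2, he3, he4, he5⟩⟩ := h
  obtain ⟨⟨gb0, gb1, gb2, gb3⟩, ⟨ge0, ge1, ge2⟩⟩ := h'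
  linarith


/-- `U` and `A` are disjoint. [cite: Polymath8b2014, Section 7.4] -/
theorem not_mem_pieceA_of_mem_pieceU {t : Fin 3 → ℝ} (h : t ∈ pieceU) : t ∉ pieceA := fun h' => by
  obtain ⟨⟨hb0, hb1, hb2, hb3⟩, ⟨he0, he1, he2, he3, he4⟩⟩ := h
  obtain ⟨⟨gb0, gb1, gb2, gb3⟩, ge0⟩ := h'
  linarith


/-- `U` and `B` are disjoint. [cite: Polymath8b2014, Section 7.4] -/
theorem not_mem_pieceB_of_mem_pieceU {t : Fin 3 → ℝ} (h : t ∈ pieceU) : t ∉ pieceB := fun h' => by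
  obtain ⟨⟨hb0, hb1, hb2, hb3⟩, ⟨he0, he1, he2, he3, he4⟩⟩ := h
  obtain ⟨⟨gb0, gb1, gb2, gb3⟩, ⟨ge0, ge1, ge2⟩⟩ := h'
  linarith


/-- `U` and `C` are disjoint. [cite: Polymath8b2014, Section 7.4] -/
theorem not_mem_pieceC_of_mem_pieceU {t : Fin 3 → ℝ} (h : t ∈ pieceU) : t ∉ pieceC := fun h' => by
  obtain ⟨⟨hb0, hb1, hb2, hb3⟩, ⟨he0, he1, he2, he3, he4⟩⟩ := h
  obtain ⟨⟨gb0, gb1, gb2, gb3⟩, ⟨ge0, ge1, ge2⟩⟩ := h'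
  linarith


/-- `U` and `E` are disjoint. [cite: Polymath8b2014, Section 7.4] -/
theorem not_mem_pieceE_of_mem_pieceU {t : Fin 3 → ℝ} (h : t ∈ pieceU) : t ∉ pieceE := fun h' => by
  obtain ⟨⟨hb0, hb1, hb2, hb3⟩, ⟨he0, he1, he2, he3, he4⟩⟩ := h
  obtain ⟨⟨gb0, gb1, gb2, gb3⟩, ⟨ge0, ge1⟩⟩ := h'
  linarith


/-- `U` and `S` are disjoint. [cite: Polymath8b2014, Section 7.4] -/
theorem not_mem_pieceS_of_mem_pieceU {t : Fin 3 → ℝ} (h : t ∈ pieceU) : t ∉ pieceS := fun h' => by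
  obtain ⟨⟨hb0, hb1, hb2, hb3⟩, ⟨he0, he1, he2, he3, he4⟩⟩ := h
  obtain ⟨⟨gb0, gb1, gb2, gb3⟩, ⟨ge0, ge1, ge2, ge3, ge4⟩⟩ := h'
  linarith


/-- `U` and `T` are disjoint. [cite: Polymath8b2014, Section 7.4] -/
theorem not_mem_pieceT_of_mem_pieceU {t : Fin 3 → ℝ} (h : t ∈ pieceU) : t ∉ pieceT := fun h' => by
  obtain ⟨⟨hb0, hb1, hb2, hb3⟩, ⟨he0, he1, he2, he3, he4⟩⟩ := h
  obtain ⟨⟨gb0, gb1, gb2, gb3⟩, ⟨ge0, ge1, ge2, ge3, ge4, ge5⟩⟩ := h'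
  linarith


/-- `U` and `G` are disjoint. [cite: Polymath8b2014, Section 7.4] -/
theorem not_mem_pieceG_of_mem_pieceU {t : Fin 3 → ℝ} (h : t ∈ pieceU) : t ∉ pieceG := fun h' => by
  obtain ⟨⟨hb0, hb1, hb2, hb3⟩, ⟨he0, he1, he2, he3, he4⟩⟩ := h
  obtain ⟨⟨gb0, gb1, gb2, gb3⟩, ⟨ge0, ge1⟩⟩ := h'
  linarith


/-- `U` and `H` are disjoint. [cite: Polymath8b2014, Section 7.4] -/
theorem not_mem_pieceH_of_mem_pieceU {t : Fin 3 → ℝ} (h : t ∈ pieceU) : t ∉ pieceH := fun h' => by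
  obtain ⟨⟨hb0, hb1, hb2, hb3⟩, ⟨he0, he1, he2, he3, he4⟩⟩ := h
  obtain ⟨⟨gb0, gb1, gb2, gb3⟩, ⟨ge0, ge1, ge2⟩⟩ := h'
  linarith


/-- `G` and `A` are disjoint. [cite: Polymath8b2014, Section 7.4] -/
theorem not_mem_pieceA_of_mem_pieceG {t : Fin 3 → ℝ} (h : t ∈ pieceG) : t ∉ pieceA := fun h' => by
  obtain ⟨⟨hb0, hb1, hb2, hb3⟩, ⟨he0, he1⟩⟩ := h
  obtain ⟨⟨gb0, gb1, gb2, gb3⟩, ge0⟩ := h'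
  linarith


/-- `G` and `B` are disjoint. [cite: Polymath8b2014, Section 7.4] -/
theorem not_mem_pieceB_of_mem_pieceG {t : Fin 3 → ℝ} (h : t ∈ pieceG) : t ∉ pieceB := fun h' => by
  obtain ⟨⟨hb0, hb1, hb2, hb3⟩, ⟨he0, he1⟩⟩ := h
  obtain ⟨⟨gb0, gb1, gb2, gb3⟩, ⟨ge0, ge1, ge2⟩⟩ := h'
  linarith


/-- `G` and `C` are disjoint. [cite: Polymath8b2014, Section 7.4] -/
theorem not_mem_pieceC_of_mem_pieceG {t : Fin 3 → ℝ} (h : t ∈ pieceG) : t ∉ pieceC := fun h' => by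
  obtain ⟨⟨hb0, hb1, hb2, hb3⟩, ⟨he0, he1⟩⟩ := h
  obtain ⟨⟨gb0, gb1, gb2, gb3⟩, ⟨ge0, ge1, ge2⟩⟩ := h'
  linarith


/-- `G` and `E` are disjoint. [cite: Polymath8b2014, Section 7.4] -/
theorem not_mem_pieceE_of_mem_pieceG {t : Fin 3 → ℝ} (h : t ∈ pieceG) : t ∉ pieceE := fun h' => by
  obtain ⟨⟨hb0, hb1, hb2, hb3⟩, ⟨he0, he1⟩⟩ := h
  obtain ⟨⟨gb0, gb1, gb2, gb3⟩, ⟨ge0, ge1⟩⟩ := h'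
  linarith


/-- `G` and `S` are disjoint. [cite: Polymath8b2014, Section 7.4] -/
theorem not_mem_pieceS_of_mem_pieceG {t : Fin 3 → ℝ} (h : t ∈ pieceG) : t ∉ pieceS := fun h' => by
  obtain ⟨⟨hb0, hb1, hb2, hb3⟩, ⟨he0, he1⟩⟩ := h
  obtain ⟨⟨gb0, gb1, gb2, gb3⟩, ⟨ge0, ge1, ge2, ge3, ge4⟩⟩ := h'
  linarith


/-- `G` and `T` are disjoint. [cite: Polymath8b2014, Section 7.4] -/
theorem not_mem_pieceT_of_mem_pieceG {t : Fin 3 → ℝ} (h : t ∈ pieceG) : t ∉ pieceT := fun h' => by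
  obtain ⟨⟨hb0, hb1, hb2, hb3⟩, ⟨he0, he1⟩⟩ := h
  obtain ⟨⟨gb0, gb1, gb2, gb3⟩, ⟨ge0, ge1, ge2, ge3, ge4, ge5⟩⟩ := h'
  linarith


/-- `G` and `U` are disjoint. [cite: Polymath8b2014, Section 7.4] -/
theorem not_mem_pieceU_of_mem_pieceG {t : Fin 3 → ℝ} (h : t ∈ pieceG) : t ∉ pieceU := fun h' => by
  obtain ⟨⟨hb0, hb1, hb2, hb3⟩, ⟨he0, he1⟩⟩ := h
  obtain ⟨⟨gb0, gb1, gb2, gb3⟩, ⟨ge0, ge1, ge2, ge3, ge4⟩⟩ := h'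
  linarith


/-- `G` and `H` are disjoint. [cite: Polymath8b2014, Section 7.4] -/
theorem not_mem_pieceH_of_mem_pieceG {t : Fin 3 → ℝ} (h : t ∈ pieceG) : t ∉ pieceH := fun h' => by
  obtain ⟨⟨hb0, hb1, hb2, hb3⟩, ⟨he0, he1⟩⟩ := h
  obtain ⟨⟨gb0, gb1, gb2, gb3⟩, ⟨ge0, ge1, ge2⟩⟩ := h'
  linarith


/-- `H` and `A` are disjoint. [cite: Polymath8b2014, Section 7.4] -/
theorem not_mem_pieceA_of_mem_pieceH {t : Fin 3 → ℝ} (h : t ∈ pieceH) : t ∉ pieceA := fun h' => by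
  obtain ⟨⟨hb0, hb1, hb2, hb3⟩, ⟨he0, he1, he2⟩⟩ := h
  obtain ⟨⟨gb0, gb1, gb2, gb3⟩, ge0⟩ := h'
  linarith


/-- `H` and `B` are disjoint. [cite: Polymath8b2014, Section 7.4] -/
theorem not_mem_pieceB_of_mem_pieceH {t : Fin 3 → ℝ} (h : t ∈ pieceH) : t ∉ pieceB := fun h' => by
  obtain ⟨⟨hb0, hb1, hb2, hb3⟩, ⟨he0, he1, he2⟩⟩ := h
  obtain ⟨⟨gb0, gb1, gb2, gb3⟩, ⟨ge0, ge1, ge2⟩⟩ := h'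
  linarith


/-- `H` and `C` are disjoint. [cite: Polymath8b2014, Section 7.4] -/
theorem not_mem_pieceC_of_mem_pieceH {t : Fin 3 → ℝ} (h : t ∈ pieceH) : t ∉ pieceC := fun h' => by
  obtain ⟨⟨hb0, hb1, hb2, hb3⟩, ⟨he0, he1, he2⟩⟩ := h
  obtain ⟨⟨gb0, gb1, gb2, gb3⟩, ⟨ge0, ge1, ge2⟩⟩ := h'
  linarith


/-- `H` and `E` are disjoint. [cite: Polymath8b2014, Section 7.4] -/
theorem not_mem_pieceE_of_mem_pieceH {t : Fin 3 → ℝ} (h : t ∈ pieceH) : t ∉ pieceE := fun h' => by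
  obtain ⟨⟨hb0, hb1, hb2, hb3⟩, ⟨he0, he1, he2⟩⟩ := h
  obtain ⟨⟨gb0, gb1, gb2, gb3⟩, ⟨ge0, ge1⟩⟩ := h'
  linarith


/-- `H` and `S` are disjoint. [cite: Polymath8b2014, Section 7.4] -/
theorem not_mem_pieceS_of_mem_pieceH {t : Fin 3 → ℝ} (h : t ∈ pieceH) : t ∉ pieceS := fun h' => by
  obtain ⟨⟨hb0, hb1, hb2, hb3⟩, ⟨he0, he1, he2⟩⟩ := h
  obtain ⟨⟨gb0, gb1, gb2, gb3⟩, ⟨ge0, ge1, ge2, ge3, ge4⟩⟩ := h'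
  linarith


/-- `H` and `T` are disjoint. [cite: Polymath8b2014, Section 7.4] -/
theorem not_mem_pieceT_of_mem_pieceH {t : Fin 3 → ℝ} (h : t ∈ pieceH) : t ∉ pieceT := fun h' => by
  obtain ⟨⟨hb0, hb1, hb2, hb3⟩, ⟨he0, he1, he2⟩⟩ := h
  obtain ⟨⟨gb0, gb1, gb2, gb3⟩, ⟨ge0, ge1, ge2, ge3, ge4, ge5⟩⟩ := h'
  linarith


/-- `H` and `U` are disjoint. [cite: Polymath8b2014, Section 7.4] -/
theorem not_mem_pieceU_of_mem_pieceH {t : Fin 3 → ℝ} (h : t ∈ pieceH) : t ∉ pieceU := fun h' => by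
  obtain ⟨⟨hb0, hb1, hb2, hb3⟩, ⟨he0, he1, he2⟩⟩ := h
  obtain ⟨⟨gb0, gb1, gb2, gb3⟩, ⟨ge0, ge1, ge2, ge3, ge4⟩⟩ := h'
  linarith


/-- `H` and `G` are disjoint. [cite: Polymath8b2014, Section 7.4] -/
theorem not_mem_pieceG_of_mem_pieceH {t : Fin 3 → ℝ} (h : t ∈ pieceH) : t ∉ pieceG := fun h' => by
  obtain ⟨⟨hb0, hb1, hb2, hb3⟩, ⟨he0, he1, he2⟩⟩ := h
  obtain ⟨⟨gb0, gb1, gb2, gb3⟩, ⟨ge0, ge1⟩⟩ := h'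
  linarith


/-- On `A`, `Gfun = F↾A`. [cite: Polymath8b2014, Section 7.4] -/
theorem Gfun_eq_of_mem_pieceA {t : Fin 3 → ℝ} (h : t ∈ pieceA) : Gfun t = polyA (t 0) (t 1) (t 2) := by
  simp only [Gfun, Set.indicator_of_mem h, Set.indicator_of_notMem (not_mem_pieceB_of_mem_pieceA h), Set.indicator_of_notMem (not_mem_pieceC_of_mem_pieceA h), Set.indicator_of_notMem (not_mem_pieceE_of_mem_pieceA h), Set.indicator_of_notMem (not_mem_pieceS_of_mem_pieceA h), Set.indicator_of_notMem (not_mem_pieceT_of_mem_pieceA h), Set.indicator_of_notMem (not_mem_pieceU_of_mem_pieceA h), Set.indicator_of_notMem (not_mem_pieceG_of_mem_pieceA h), Set.indicator_of_notMem (not_mem_pieceH_of_mem_pieceA h)]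
  ring


/-- On `B`, `Gfun = F↾B`. [cite: Polymath8b2014, Section 7.4] -/
theorem Gfun_eq_of_mem_pieceB {t : Fin 3 → ℝ} (h : t ∈ pieceB) : Gfun t = polyB (t 0) (t 1) (t 2) := by
  simp only [Gfun, Set.indicator_of_mem h, Set.indicator_of_notMem (not_mem_pieceA_of_mem_pieceB h), Set.indicator_of_notMem (not_mem_pieceC_of_mem_pieceB h), Set.indicator_of_notMem (not_mem_pieceE_of_mem_pieceB h), Set.indicator_of_notMem (not_mem_pieceS_of_mem_pieceB h), Set.indicator_of_notMem (not_mem_pieceT_of_mem_pieceB h), Set.indicator_of_notMem (not_mem_pieceU_of_mem_pieceB h), Set.indicator_of_notMem (not_mem_pieceG_of_mem_pieceB h), Set.indicator_of_notMem (not_mem_pieceH_of_mem_pieceB h)]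
  ring


/-- On `C`, `Gfun = F↾C`. [cite: Polymath8b2014, Section 7.4] -/
theorem Gfun_eq_of_mem_pieceC {t : Fin 3 → ℝ} (h : t ∈ pieceC) : Gfun t = polyC (t 0) (t 1) (t 2) := by
  simp only [Gfun, Set.indicator_of_mem h, Set.indicator_of_notMem (not_mem_pieceA_of_mem_pieceC h), Set.indicator_of_notMem (not_mem_pieceB_of_mem_pieceC h), Set.indicator_of_notMem (not_mem_pieceE_of_mem_pieceC h), Set.indicator_of_notMem (not_mem_pieceS_of_mem_pieceC h), Set.indicator_of_notMem (not_mem_pieceT_of_mem_pieceC h), Set.indicator_of_notMem (not_mem_pieceU_of_mem_pieceC h), Set.indicator_of_notMem (not_mem_pieceG_of_mem_pieceC h), Set.indicator_of_notMem (not_mem_pieceH_of_mem_pieceC h)]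
  ring


/-- On `E`, `Gfun = F↾E`. [cite: Polymath8b2014, Section 7.4] -/
theorem Gfun_eq_of_mem_pieceE {t : Fin 3 → ℝ} (h : t ∈ pieceE) : Gfun t = polyE (t 0) (t 1) (t 2) := by
  simp only [Gfun, Set.indicator_of_mem h, Set.indicator_of_notMem (not_mem_pieceA_of_mem_pieceE h), Set.indicator_of_notMem (not_mem_pieceB_of_mem_pieceE h), Set.indicator_of_notMem (not_mem_pieceC_of_mem_pieceE h), Set.indicator_of_notMem (not_mem_pieceS_of_mem_pieceE h), Set.indicator_of_notMem (not_mem_pieceT_of_mem_pieceE h), Set.indicator_of_notMem (not_mem_pieceU_of_mem_pieceE h), Set.indicator_of_notMem (not_mem_pieceG_of_mem_pieceE h), Set.indicator_of_notMem (not_mem_pieceH_of_mem_pieceE h)]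
  ring


/-- On `S`, `Gfun = F↾S`. [cite: Polymath8b2014, Section 7.4] -/
theorem Gfun_eq_of_mem_pieceS {t : Fin 3 → ℝ} (h : t ∈ pieceS) : Gfun t = polyS (t 0) (t 1) (t 2) := by
  simp only [Gfun, Set.indicator_of_mem h, Set.indicator_of_notMem (not_mem_pieceA_of_mem_pieceS h), Set.indicator_of_notMem (not_mem_pieceB_of_mem_pieceS h), Set.indicator_of_notMem (not_mem_pieceC_of_mem_pieceS h), Set.indicator_of_notMem (not_mem_pieceE_of_mem_pieceS h), Set.indicator_of_notMem (not_mem_pieceT_of_mem_pieceS h), Set.indicator_of_notMem (not_mem_pieceU_of_mem_pieceS h), Set.indicator_of_notMem (not_mem_pieceG_of_mem_pieceS h), Set.indicator_of_notMem (not_mem_pieceH_of_mem_pieceS h)]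
  ring


/-- On `T`, `Gfun = F↾T`. [cite: Polymath8b2014, Section 7.4] -/
theorem Gfun_eq_of_mem_pieceT {t : Fin 3 → ℝ} (h : t ∈ pieceT) : Gfun t = polyT (t 0) (t 1) (t 2) := by
  simp only [Gfun, Set.indicator_of_mem h, Set.indicator_of_notMem (not_mem_pieceA_of_mem_pieceT h), Set.indicator_of_notMem (not_mem_pieceB_of_mem_pieceT h), Set.indicator_of_notMem (not_mem_pieceC_of_mem_pieceT h), Set.indicator_of_notMem (not_mem_pieceE_of_mem_pieceT h), Set.indicator_of_notMem (not_mem_pieceS_of_mem_pieceT h), Set.indicator_of_notMem (not_mem_pieceU_of_mem_pieceT h), Set.indicator_of_notMem (not_mem_pieceG_of_mem_pieceT h), Set.indicator_of_notMem (not_mem_pieceH_of_mem_pieceT h)]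
  ring


/-- On `U`, `Gfun = F↾U`. [cite: Polymath8b2014, Section 7.4] -/
theorem Gfun_eq_of_mem_pieceU {t : Fin 3 → ℝ} (h : t ∈ pieceU) : Gfun t = polyU (t 0) (t 1) (t 2) := by
  simp only [Gfun, Set.indicator_of_mem h, Set.indicator_of_notMem (not_mem_pieceA_of_mem_pieceU h), Set.indicator_of_notMem (not_mem_pieceB_of_mem_pieceU h), Set.indicator_of_notMem (not_mem_pieceC_of_mem_pieceU h), Set.indicator_of_notMem (not_mem_pieceE_of_mem_pieceU h), Set.indicator_of_notMem (not_mem_pieceS_of_mem_pieceU h), Set.indicator_of_notMem (not_mem_pieceT_of_mem_pieceU h), Set.indicator_of_notMem (not_mem_pieceG_of_mem_pieceU h), Set.indicator_of_notMem (not_mem_pieceH_of_mem_pieceU h)]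
  ring


/-- On `G`, `Gfun = F↾G`. [cite: Polymath8b2014, Section 7.4] -/
theorem Gfun_eq_of_mem_pieceG {t : Fin 3 → ℝ} (h : t ∈ pieceG) : Gfun t = polyG (t 0) (t 1) (t 2) := by
  simp only [Gfun, Set.indicator_of_mem h, Set.indicator_of_notMem (not_mem_pieceA_of_mem_pieceG h), Set.indicator_of_notMem (not_mem_pieceB_of_mem_pieceG h), Set.indicator_of_notMem (not_mem_pieceC_of_mem_pieceG h), Set.indicator_of_notMem (not_mem_pieceE_of_mem_pieceG h), Set.indicator_of_notMem (not_mem_pieceS_of_mem_pieceG h), Set.indicator_of_notMem (not_mem_pieceT_of_mem_pieceG h), Set.indicator_of_notMem (not_mem_pieceU_of_mem_pieceG h), Set.indicator_of_notMem (not_mem_pieceH_of_mem_pieceG h)]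
  ring


/-- On `H`, `Gfun = F↾H`. [cite: Polymath8b2014, Section 7.4] -/
theorem Gfun_eq_of_mem_pieceH {t : Fin 3 → ℝ} (h : t ∈ pieceH) : Gfun t = polyH (t 0) (t 1) (t 2) := by
  simp only [Gfun, Set.indicator_of_mem h, Set.indicator_of_notMem (not_mem_pieceA_of_mem_pieceH h), Set.indicator_of_notMem (not_mem_pieceB_of_mem_pieceH h), Set.indicator_of_notMem (not_mem_pieceC_of_mem_pieceH h), Set.indicator_of_notMem (not_mem_pieceE_of_mem_pieceH h), Set.indicator_of_notMem (not_mem_pieceS_of_mem_pieceH h), Set.indicator_of_notMem (not_mem_pieceT_of_mem_pieceH h), Set.indicator_of_notMem (not_mem_pieceU_of_mem_pieceH h), Set.indicator_of_notMem (not_mem_pieceG_of_mem_pieceH h)]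
  ring


/-- `Gfun²` as a sum of indicator terms (the pieces are disjoint, so no cross terms).
[cite: Polymath8b2014, Section 7.4] -/
def Gsq (t : Fin 3 → ℝ) : ℝ :=
  pieceA.indicator (fun t => polyA (t 0) (t 1) (t 2) ^ 2) t +
  pieceB.indicator (fun t => polyB (t 0) (t 1) (t 2) ^ 2) t +
  pieceC.indicator (fun t => polyC (t 0) (t 1) (t 2) ^ 2) t +
  pieceE.indicator (fun t => polyE (t 0) (t 1) (t 2) ^ 2) t +
  pieceS.indicator (fun t => polyS (t 0) (t 1) (t 2) ^ 2) t +
  pieceT.indicator (fun t => polyT (t 0) (t 1) (t 2) ^ 2) t +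
  pieceU.indicator (fun t => polyU (t 0) (t 1) (t 2) ^ 2) t +
  pieceG.indicator (fun t => polyG (t 0) (t 1) (t 2) ^ 2) t +
  pieceH.indicator (fun t => polyH (t 0) (t 1) (t 2) ^ 2) t


/-- `Gfun t ^ 2 = Gsq t`. [cite: Polymath8b2014, Section 7.4] -/
theorem Gfun_sq (t : Fin 3 → ℝ) : Gfun t ^ 2 = Gsq t := by
  by_cases hA : t ∈ pieceA
  · rw [Gfun_eq_of_mem_pieceA hA]
    simp only [Gsq, Set.indicator_of_mem hA, Set.indicator_of_notMem (not_mem_pieceB_of_mem_pieceA hA), Set.indicator_of_notMem (not_mem_pieceC_of_mem_pieceA hA), Set.indicator_of_notMem (not_mem_pieceE_of_mem_pieceA hA), Set.indicator_of_notMem (not_mem_pieceS_of_mem_pieceA hA), Set.indicator_of_notMem (not_mem_pieceT_of_mem_pieceA hA), Set.indicator_of_notMem (not_mem_pieceU_of_mem_pieceA hA), Set.indicator_of_notMem (not_mem_pieceG_of_mem_pieceA hA), Set.indicator_of_notMem (not_mem_pieceH_of_mem_pieceA hA)]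
    ring
  by_cases hB : t ∈ pieceB
  · rw [Gfun_eq_of_mem_pieceB hB]
    simp only [Gsq, Set.indicator_of_mem hB, Set.indicator_of_notMem (not_mem_pieceA_of_mem_pieceB hB), Set.indicator_of_notMem (not_mem_pieceC_of_mem_pieceB hB), Set.indicator_of_notMem (not_mem_pieceE_of_mem_pieceB hB), Set.indicator_of_notMem (not_mem_pieceS_of_mem_pieceB hB), Set.indicator_of_notMem (not_mem_pieceT_of_mem_pieceB hB), Set.indicator_of_notMem (not_mem_pieceU_of_mem_pieceB hB), Set.indicator_of_notMem (not_mem_pieceG_of_mem_pieceB hB), Set.indicator_of_notMem (not_mem_pieceH_of_mem_pieceB hB)]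
    ring
  by_cases hC : t ∈ pieceC
  · rw [Gfun_eq_of_mem_pieceC hC]
    simp only [Gsq, Set.indicator_of_mem hC, Set.indicator_of_notMem (not_mem_pieceA_of_mem_pieceC hC), Set.indicator_of_notMem (not_mem_pieceB_of_mem_pieceC hC), Set.indicator_of_notMem (not_mem_pieceE_of_mem_pieceC hC), Set.indicator_of_notMem (not_mem_pieceS_of_mem_pieceC hC), Set.indicator_of_notMem (not_mem_pieceT_of_mem_pieceC hC), Set.indicator_of_notMem (not_mem_pieceU_of_mem_pieceC hC), Set.indicator_of_notMem (not_mem_pieceG_of_mem_pieceC hC), Set.indicator_of_notMem (not_mem_pieceH_of_mem_pieceC hC)]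
    ring
  by_cases hE : t ∈ pieceE
  · rw [Gfun_eq_of_mem_pieceE hE]
    simp only [Gsq, Set.indicator_of_mem hE, Set.indicator_of_notMem (not_mem_pieceA_of_mem_pieceE hE), Set.indicator_of_notMem (not_mem_pieceB_of_mem_pieceE hE), Set.indicator_of_notMem (not_mem_pieceC_of_mem_pieceE hE), Set.indicator_of_notMem (not_mem_pieceS_of_mem_pieceE hE), Set.indicator_of_notMem (not_mem_pieceT_of_mem_pieceE hE), Set.indicator_of_notMem (not_mem_pieceU_of_mem_pieceE hE), Set.indicator_of_notMem (not_mem_pieceG_of_mem_pieceE hE), Set.indicator_of_notMem (not_mem_pieceH_of_mem_pieceE hE)]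
    ring
  by_cases hS : t ∈ pieceS
  · rw [Gfun_eq_of_mem_pieceS hS]
    simp only [Gsq, Set.indicator_of_mem hS, Set.indicator_of_notMem (not_mem_pieceA_of_mem_pieceS hS), Set.indicator_of_notMem (not_mem_pieceB_of_mem_pieceS hS), Set.indicator_of_notMem (not_mem_pieceC_of_mem_pieceS hS), Set.indicator_of_notMem (not_mem_pieceE_of_mem_pieceS hS), Set.indicator_of_notMem (not_mem_pieceT_of_mem_pieceS hS), Set.indicator_of_notMem (not_mem_pieceU_of_mem_pieceS hS), Set.indicator_of_notMem (not_mem_pieceG_of_mem_pieceS hS), Set.indicator_of_notMem (not_mem_pieceH_of_mem_pieceS hS)]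
    ring
  by_cases hT : t ∈ pieceT
  · rw [Gfun_eq_of_mem_pieceT hT]
    simp only [Gsq, Set.indicator_of_mem hT, Set.indicator_of_notMem (not_mem_pieceA_of_mem_pieceT hT), Set.indicator_of_notMem (not_mem_pieceB_of_mem_pieceT hT), Set.indicator_of_notMem (not_mem_pieceC_of_mem_pieceT hT), Set.indicator_of_notMem (not_mem_pieceE_of_mem_pieceT hT), Set.indicator_of_notMem (not_mem_pieceS_of_mem_pieceT hT), Set.indicator_of_notMem (not_mem_pieceU_of_mem_pieceT hT), Set.indicator_of_notMem (not_mem_pieceG_of_mem_pieceT hT), Set.indicator_of_notMem (not_mem_pieceH_of_mem_pieceT hT)]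
    ring
  by_cases hU : t ∈ pieceU
  · rw [Gfun_eq_of_mem_pieceU hU]
    simp only [Gsq, Set.indicator_of_mem hU, Set.indicator_of_notMem (not_mem_pieceA_of_mem_pieceU hU), Set.indicator_of_notMem (not_mem_pieceB_of_mem_pieceU hU), Set.indicator_of_notMem (not_mem_pieceC_of_mem_pieceU hU), Set.indicator_of_notMem (not_mem_pieceE_of_mem_pieceU hU), Set.indicator_of_notMem (not_mem_pieceS_of_mem_pieceU hU), Set.indicator_of_notMem (not_mem_pieceT_of_mem_pieceU hU), Set.indicator_of_notMem (not_mem_pieceG_of_mem_pieceU hU), Set.indicator_of_notMem (not_mem_pieceH_of_mem_pieceU hU)]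
    ring
  by_cases hG : t ∈ pieceG
  · rw [Gfun_eq_of_mem_pieceG hG]
    simp only [Gsq, Set.indicator_of_mem hG, Set.indicator_of_notMem (not_mem_pieceA_of_mem_pieceG hG), Set.indicator_of_notMem (not_mem_pieceB_of_mem_pieceG hG), Set.indicator_of_notMem (not_mem_pieceC_of_mem_pieceG hG), Set.indicator_of_notMem (not_mem_pieceE_of_mem_pieceG hG), Set.indicator_of_notMem (not_mem_pieceS_of_mem_pieceG hG), Set.indicator_of_notMem (not_mem_pieceT_of_mem_pieceG hG), Set.indicator_of_notMem (not_mem_pieceU_of_mem_pieceG hG), Set.indicator_of_notMem (not_mem_pieceH_of_mem_pieceG hG)]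
    ring
  by_cases hH : t ∈ pieceH
  · rw [Gfun_eq_of_mem_pieceH hH]
    simp only [Gsq, Set.indicator_of_mem hH, Set.indicator_of_notMem (not_mem_pieceA_of_mem_pieceH hH), Set.indicator_of_notMem (not_mem_pieceB_of_mem_pieceH hH), Set.indicator_of_notMem (not_mem_pieceC_of_mem_pieceH hH), Set.indicator_of_notMem (not_mem_pieceE_of_mem_pieceH hH), Set.indicator_of_notMem (not_mem_pieceS_of_mem_pieceH hH), Set.indicator_of_notMem (not_mem_pieceT_of_mem_pieceH hH), Set.indicator_of_notMem (not_mem_pieceU_of_mem_pieceH hH), Set.indicator_of_notMem (not_mem_pieceG_of_mem_pieceH hH)]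
    ring
  have h0 : Gfun t = 0 := by simp only [Gfun, Set.indicator_of_notMem hA, Set.indicator_of_notMem hB, Set.indicator_of_notMem hC, Set.indicator_of_notMem hE, Set.indicator_of_notMem hS, Set.indicator_of_notMem hT, Set.indicator_of_notMem hU, Set.indicator_of_notMem hG, Set.indicator_of_notMem hH]; ring
  rw [h0]
  simp only [Gsq, Set.indicator_of_notMem hA, Set.indicator_of_notMem hB, Set.indicator_of_notMem hC, Set.indicator_of_notMem hE, Set.indicator_of_notMem hS, Set.indicator_of_notMem hT, Set.indicator_of_notMem hU, Set.indicator_of_notMem hG, Set.indicator_of_notMem hH]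
  ring


/-- `F3` at a point whose rearrangement `(t 0, t 1, t 2)` is ordered (`0 < t 1 < t 0 < t 2`): only that term survives.
[cite: Polymath8b2014, Section 7.4] -/
theorem F3_eq_012 {t : Fin 3 → ℝ} (h : 0 < t 1 ∧ t 1 < t 0 ∧ t 0 < t 2) : F3 t = Gfun ![t 0, t 1, t 2] := by
  obtain ⟨h1, h2, h3⟩ := h
  simp only [F3]
  rw [Gfun_eq_zero_of_not_ordered (t := ![t 1, t 0, t 2]) (by
    simp only [Matrix.cons_val_zero, Matrix.cons_val_one, Matrix.cons_val_two, Matrix.head_cons, Matrix.tail_cons]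
    rintro ⟨g1, g2, g3⟩
    linarith)]
  rw [Gfun_eq_zero_of_not_ordered (t := ![t 0, t 2, t 1]) (by
    simp only [Matrix.cons_val_zero, Matrix.cons_val_one, Matrix.cons_val_two, Matrix.head_cons, Matrix.tail_cons]
    rintro ⟨g1, g2, g3⟩
    linarith)]
  rw [Gfun_eq_zero_of_not_ordered (t := ![t 2, t 1, t 0]) (by
    simp only [Matrix.cons_val_zero, Matrix.cons_val_one, Matrix.cons_val_two, Matrix.head_cons, Matrix.tail_cons]
    rintro ⟨g1, g2, g3⟩
    linarith)]
  rw [Gfun_eq_zero_of_not_ordered (t := ![t 1, t 2, t 0]) (by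
    simp only [Matrix.cons_val_zero, Matrix.cons_val_one, Matrix.cons_val_two, Matrix.head_cons, Matrix.tail_cons]
    rintro ⟨g1, g2, g3⟩
    linarith)]
  rw [Gfun_eq_zero_of_not_ordered (t := ![t 2, t 0, t 1]) (by
    simp only [Matrix.cons_val_zero, Matrix.cons_val_one, Matrix.cons_val_two, Matrix.head_cons, Matrix.tail_cons]
    rintro ⟨g1, g2, g3⟩
    linarith)]
  simp


/-- `F3` at a point whose rearrangement `(t 1, t 0, t 2)` is ordered (`0 < t 0 < t 1 < t 2`): only that term survives.
[cite: Polymath8b2014, Section 7.4] -/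
theorem F3_eq_102 {t : Fin 3 → ℝ} (h : 0 < t 0 ∧ t 0 < t 1 ∧ t 1 < t 2) : F3 t = Gfun ![t 1, t 0, t 2] := by
  obtain ⟨h1, h2, h3⟩ := h
  simp only [F3]
  rw [Gfun_eq_zero_of_not_ordered (t := ![t 0, t 1, t 2]) (by
    simp only [Matrix.cons_val_zero, Matrix.cons_val_one, Matrix.cons_val_two, Matrix.head_cons, Matrix.tail_cons]
    rintro ⟨g1, g2, g3⟩
    linarith)]
  rw [Gfun_eq_zero_of_not_ordered (t := ![t 0, t 2, t 1]) (by
    simp only [Matrix.cons_val_zero, Matrix.cons_val_one, Matrix.cons_val_two, Matrix.head_cons, Matrix.tail_cons]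
    rintro ⟨g1, g2, g3⟩
    linarith)]
  rw [Gfun_eq_zero_of_not_ordered (t := ![t 2, t 1, t 0]) (by
    simp only [Matrix.cons_val_zero, Matrix.cons_val_one, Matrix.cons_val_two, Matrix.head_cons, Matrix.tail_cons]
    rintro ⟨g1, g2, g3⟩
    linarith)]
  rw [Gfun_eq_zero_of_not_ordered (t := ![t 1, t 2, t 0]) (by
    simp only [Matrix.cons_val_zero, Matrix.cons_val_one, Matrix.cons_val_two, Matrix.head_cons, Matrix.tail_cons]
    rintro ⟨g1, g2, g3⟩
    linarith)]
  rw [Gfun_eq_zero_of_not_ordered (t := ![t 2, t 0, t 1]) (by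
    simp only [Matrix.cons_val_zero, Matrix.cons_val_one, Matrix.cons_val_two, Matrix.head_cons, Matrix.tail_cons]
    rintro ⟨g1, g2, g3⟩
    linarith)]
  simp


/-- `F3` at a point whose rearrangement `(t 0, t 2, t 1)` is ordered (`0 < t 2 < t 0 < t 1`): only that term survives.
[cite: Polymath8b2014, Section 7.4] -/
theorem F3_eq_021 {t : Fin 3 → ℝ} (h : 0 < t 2 ∧ t 2 < t 0 ∧ t 0 < t 1) : F3 t = Gfun ![t 0, t 2, t 1] := by
  obtain ⟨h1, h2, h3⟩ := h
  simp only [F3]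
  rw [Gfun_eq_zero_of_not_ordered (t := ![t 0, t 1, t 2]) (by
    simp only [Matrix.cons_val_zero, Matrix.cons_val_one, Matrix.cons_val_two, Matrix.head_cons, Matrix.tail_cons]
    rintro ⟨g1, g2, g3⟩
    linarith)]
  rw [Gfun_eq_zero_of_not_ordered (t := ![t 1, t 0, t 2]) (by
    simp only [Matrix.cons_val_zero, Matrix.cons_val_one, Matrix.cons_val_two, Matrix.head_cons, Matrix.tail_cons]
    rintro ⟨g1, g2, g3⟩
    linarith)]
  rw [Gfun_eq_zero_of_not_ordered (t := ![t 2, t 1, t 0]) (by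
    simp only [Matrix.cons_val_zero, Matrix.cons_val_one, Matrix.cons_val_two, Matrix.head_cons, Matrix.tail_cons]
    rintro ⟨g1, g2, g3⟩
    linarith)]
  rw [Gfun_eq_zero_of_not_ordered (t := ![t 1, t 2, t 0]) (by
    simp only [Matrix.cons_val_zero, Matrix.cons_val_one, Matrix.cons_val_two, Matrix.head_cons, Matrix.tail_cons]
    rintro ⟨g1, g2, g3⟩
    linarith)]
  rw [Gfun_eq_zero_of_not_ordered (t := ![t 2, t 0, t 1]) (by
    simp only [Matrix.cons_val_zero, Matrix.cons_val_one, Matrix.cons_val_two, Matrix.head_cons, Matrix.tail_cons]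
    rintro ⟨g1, g2, g3⟩
    linarith)]
  simp


/-- `F3` at a point whose rearrangement `(t 2, t 1, t 0)` is ordered (`0 < t 1 < t 2 < t 0`): only that term survives.
[cite: Polymath8b2014, Section 7.4] -/
theorem F3_eq_210 {t : Fin 3 → ℝ} (h : 0 < t 1 ∧ t 1 < t 2 ∧ t 2 < t 0) : F3 t = Gfun ![t 2, t 1, t 0] := by
  obtain ⟨h1, h2, h3⟩ := h
  simp only [F3]
  rw [Gfun_eq_zero_of_not_ordered (t := ![t 0, t 1, t 2]) (by
    simp only [Matrix.cons_val_zero, Matrix.cons_val_one, Matrix.cons_val_two, Matrix.head_cons, Matrix.tail_cons]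
    rintro ⟨g1, g2, g3⟩
    linarith)]
  rw [Gfun_eq_zero_of_not_ordered (t := ![t 1, t 0, t 2]) (by
    simp only [Matrix.cons_val_zero, Matrix.cons_val_one, Matrix.cons_val_two, Matrix.head_cons, Matrix.tail_cons]
    rintro ⟨g1, g2, g3⟩
    linarith)]
  rw [Gfun_eq_zero_of_not_ordered (t := ![t 0, t 2, t 1]) (by
    simp only [Matrix.cons_val_zero, Matrix.cons_val_one, Matrix.cons_val_two, Matrix.head_cons, Matrix.tail_cons]
    rintro ⟨g1, g2, g3⟩
    linarith)]
  rw [Gfun_eq_zero_of_not_ordered (t := ![t 1, t 2, t 0]) (by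
    simp only [Matrix.cons_val_zero, Matrix.cons_val_one, Matrix.cons_val_two, Matrix.head_cons, Matrix.tail_cons]
    rintro ⟨g1, g2, g3⟩
    linarith)]
  rw [Gfun_eq_zero_of_not_ordered (t := ![t 2, t 0, t 1]) (by
    simp only [Matrix.cons_val_zero, Matrix.cons_val_one, Matrix.cons_val_two, Matrix.head_cons, Matrix.tail_cons]
    rintro ⟨g1, g2, g3⟩
    linarith)]
  simp


/-- `F3` at a point whose rearrangement `(t 1, t 2, t 0)` is ordered (`0 < t 2 < t 1 < t 0`): only that term survives.
[cite: Polymath8b2014, Section 7.4] -/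
theorem F3_eq_120 {t : Fin 3 → ℝ} (h : 0 < t 2 ∧ t 2 < t 1 ∧ t 1 < t 0) : F3 t = Gfun ![t 1, t 2, t 0] := by
  obtain ⟨h1, h2, h3⟩ := h
  simp only [F3]
  rw [Gfun_eq_zero_of_not_ordered (t := ![t 0, t 1, t 2]) (by
    simp only [Matrix.cons_val_zero, Matrix.cons_val_one, Matrix.cons_val_two, Matrix.head_cons, Matrix.tail_cons]
    rintro ⟨g1, g2, g3⟩
    linarith)]
  rw [Gfun_eq_zero_of_not_ordered (t := ![t 1, t 0, t 2]) (by
    simp only [Matrix.cons_val_zero, Matrix.cons_val_one, Matrix.cons_val_two, Matrix.head_cons, Matrix.tail_cons]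
    rintro ⟨g1, g2, g3⟩
    linarith)]
  rw [Gfun_eq_zero_of_not_ordered (t := ![t 0, t 2, t 1]) (by
    simp only [Matrix.cons_val_zero, Matrix.cons_val_one, Matrix.cons_val_two, Matrix.head_cons, Matrix.tail_cons]
    rintro ⟨g1, g2, g3⟩
    linarith)]
  rw [Gfun_eq_zero_of_not_ordered (t := ![t 2, t 1, t 0]) (by
    simp only [Matrix.cons_val_zero, Matrix.cons_val_one, Matrix.cons_val_two, Matrix.head_cons, Matrix.tail_cons]
    rintro ⟨g1, g2, g3⟩
    linarith)]
  rw [Gfun_eq_zero_of_not_ordered (t := ![t 2, t 0, t 1]) (by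
    simp only [Matrix.cons_val_zero, Matrix.cons_val_one, Matrix.cons_val_two, Matrix.head_cons, Matrix.tail_cons]
    rintro ⟨g1, g2, g3⟩
    linarith)]
  simp


/-- `F3` at a point whose rearrangement `(t 2, t 0, t 1)` is ordered (`0 < t 0 < t 2 < t 1`): only that term survives.
[cite: Polymath8b2014, Section 7.4] -/
theorem F3_eq_201 {t : Fin 3 → ℝ} (h : 0 < t 0 ∧ t 0 < t 2 ∧ t 2 < t 1) : F3 t = Gfun ![t 2, t 0, t 1] := by
  obtain ⟨h1, h2, h3⟩ := h
  simp only [F3]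
  rw [Gfun_eq_zero_of_not_ordered (t := ![t 0, t 1, t 2]) (by
    simp only [Matrix.cons_val_zero, Matrix.cons_val_one, Matrix.cons_val_two, Matrix.head_cons, Matrix.tail_cons]
    rintro ⟨g1, g2, g3⟩
    linarith)]
  rw [Gfun_eq_zero_of_not_ordered (t := ![t 1, t 0, t 2]) (by
    simp only [Matrix.cons_val_zero, Matrix.cons_val_one, Matrix.cons_val_two, Matrix.head_cons, Matrix.tail_cons]
    rintro ⟨g1, g2, g3⟩
    linarith)]
  rw [Gfun_eq_zero_of_not_ordered (t := ![t 0, t 2, t 1]) (by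
    simp only [Matrix.cons_val_zero, Matrix.cons_val_one, Matrix.cons_val_two, Matrix.head_cons, Matrix.tail_cons]
    rintro ⟨g1, g2, g3⟩
    linarith)]
  rw [Gfun_eq_zero_of_not_ordered (t := ![t 2, t 1, t 0]) (by
    simp only [Matrix.cons_val_zero, Matrix.cons_val_one, Matrix.cons_val_two, Matrix.head_cons, Matrix.tail_cons]
    rintro ⟨g1, g2, g3⟩
    linarith)]
  rw [Gfun_eq_zero_of_not_ordered (t := ![t 1, t 2, t 0]) (by
    simp only [Matrix.cons_val_zero, Matrix.cons_val_one, Matrix.cons_val_two, Matrix.head_cons, Matrix.tail_cons]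
    rintro ⟨g1, g2, g3⟩
    linarith)]
  simp

end GEHCutoff

end Literature.NumberTheory.Sieve
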